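import Mathlib.MeasureTheory.Measure.MeasuredSets
import Mathlib.Dynamics.Ergodic.Ergodic
import Literature.Probability.Process.KolmogorovExtensionProofs
import Literature.Probability.Percolation.LocalEvents
import Literature.Probability.Percolation.LocalEventsComparison
import Literature.Probability.Percolation.ZeroOneLawMixing
import HarnessLib

/-!
# Local (thermodynamic) limits of lattice measures: existence, uniqueness, transfer, zero–one law

Topic `Literature/Probability/Percolation`, namespace `Literature.StatMech`. Generic measure theory on the
configuration space `Set ι` (sites or bonds indexed by any type `ι`; `SiteConfig`,
`BondConfig = Set (Sym2 V)`), assembled for the infinite-volume limits of dependent lattice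
measures — the use case being the infinite-volume random-current measures of
Aizenman–Duminil-Copin–Sidoravicius, CMP 334 (2015), Thm. 2.3: "(R1) convergence on local events,
(R2) translation invariance, (R3) ergodicity", whose proof reduces each property to statements
about local events. Everything here is folklore; the only deep input is Kolmogorov's extension
theorem, a theorem of the tree (`Literature.Probability.Process.isProjectiveLimit_projectiveLimit_holds`,
`KolmogorovExtensionProofs.lean`).

* **Complements to the algebra of local events** (the ring/π-system/generation/uniqueness/
  approximation facts are the tree's `LocalEvents.lean`: `isSetRing_isLocalEvent`,
  `isPiSystem_isLocalEvent`, `generateFrom_isLocalEvent`, `ext_of_isLocalEvent`,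
  `exists_isLocalEvent_measure_symmDiff_lt`; the passage of inequalities `ν ≤ μ` from local events
  to all events is the tree's `measure_le_of_forall_isLocalEvent_le`, `LocalEventsComparison.lean`):
  local events pull back under relabellings (`IsLocalEvent.preimage_relabel`), and invariance
  under a relabelling of the coordinates is decided on local events
  (`measurePreserving_relabel_of_isLocalEvent`).
* **Existence and uniqueness of the local limit** (`exists_measure_tendsto_of_isLocalEvent`,
  `measure_unique_of_tendsto_isLocalEvent`): if `μ_L` are probability measures on `Set ι` and
  `μ_L(A)` converges for every local `A`, there is a unique probability measure `μ`
  with `μ(A) = lim μ_L(A)` on local events — the limits of the finite-dimensional laws (window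
  projections `windowProj J : Set ι → (J → Bool)`) form a projective family on the finite spaces
  `{0,1}^J`, extended by Kolmogorov's theorem on `ι → Bool` and transported by the measurable
  equivalence `boolFunEquivSet : (ι → Bool) ≃ᵐ Set ι`.
* **Zero–one law under asymptotic mixing, configuration-space form**
  (`measure_eq_zero_or_one_of_asymptotic_mixing_isLocalEvent`,
  `ergodic_relabel_of_asymptotic_mixing_isLocalEvent`): the tree's abstract law
  `measure_eq_zero_or_one_of_preimage_eq_of_mixing` (`ZeroOneLawMixing.lean`) specialised to the
  ring of local events and a relabelling of the coordinates (ADS15, proof of R3).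
* **Transfer to the limit** of inequalities between local probabilities
  (`le_of_tendsto_isLocalEvent`), of the support (`measure_setOf_mem_eq_zero_of_tendsto`,
  `ae_subset_of_measure_setOf_mem_eq_zero`) and of insertion-type inequalities
  `c μ{ω ∪ F ∈ A} ≤ μ(A)` from local to all events (`mul_measure_preimage_union_le_of_isLocalEvent`).

## References

* M. Aizenman, H. Duminil-Copin, V. Sidoravicius, *Random currents and continuity of Ising
  model's spontaneous magnetization*, Comm. Math. Phys. **334** (2015) 719–742, Thm. 2.3 and its
  proof [AizenmanDuminilCopinSidoraviciusCMP2015].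
* G. Grimmett, *Percolation*, 2nd ed., Springer 1999, §2.2 [GrimmettPercolation1999].
* A. N. Kolmogorov, *Grundbegriffe* (1933), Ch. III §4 (via the tree's `KolmogorovExtension`).

## Mathlib status

Mathlib has cylinders and projective families (`MeasureTheory.cylinder`,
`IsProjectiveMeasureFamily`, `IsProjectiveLimit`) but no existence theorem for projective limits
(the tree's `KolmogorovExtensionProofs.lean` provides it) and no configuration-space API. Anchors:
`exists_measure_symmDiff_lt_of_generateFrom_isSetRing`, `ext_of_generate_finite`,
`MeasurableSpace.comap_le_iff_le_map`, `measurable_to_prop`, `measurable_to_bool`,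
`Finset.measurable_restrict₂`, `tendsto_finsetSum`, `tendsto_nhds_unique`,
`IsProjectiveLimit.measure_cylinder`, `PreErgodic`, `Ergodic`, `measure_biUnion_null_iff`.
-/

noncomputable section

open MeasureTheory Filter Topology Set
open scoped ENNReal symmDiff

namespace Literature.Probability.Percolation

variable {ι κ : Type*}

/-! ### Complements to the algebra of local events (`LocalEvents.lean`) -/

section LocalAlgebra

/-- Local events pull back to local events under relabellings of the coordinates. [folklore] -/
theorem IsLocalEvent.preimage_relabel (e : ι ≃ κ) {A : Set (Set κ)} (hA : IsLocalEvent A) :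
    IsLocalEvent (SiteConfig.relabel e ⁻¹' A) := by
  classical
  obtain ⟨F, hF⟩ := hA
  refine ⟨F.map e.symm.toEmbedding, ?_⟩
  rw [determinedBy_iff] at hF ⊢
  intro ω ω' hω
  simp only [Set.mem_preimage]
  refine hF _ _ ?_
  ext z
  simp only [Set.mem_inter_iff, Finset.mem_coe]
  have key : ∀ z ∈ F, (z ∈ SiteConfig.relabel e ω ↔ z ∈ SiteConfig.relabel e ω') := by
    intro z hz
    rw [SiteConfig.mem_relabel_iff, SiteConfig.mem_relabel_iff]
    have hz' : e.symm z ∈ (↑(F.map e.symm.toEmbedding) : Set ι) := by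
      rw [Finset.coe_map]; exact ⟨z, hz, rfl⟩
    have := Set.ext_iff.1 hω (e.symm z)
    simp only [Set.mem_inter_iff, hz', and_true] at this
    exact this
  constructor
  · rintro ⟨h1, h2⟩; exact ⟨(key z h2).1 h1, h2⟩
  · rintro ⟨h1, h2⟩; exact ⟨(key z h2).2 h1, h2⟩

/-- **Invariance is decided on local events**: a finite measure is invariant under a relabelling of
the coordinates as soon as the relabelling preserves the measure of every local event. [folklore] -/
theorem measurePreserving_relabel_of_isLocalEvent (e : ι ≃ ι) {μ : Measure (Set ι)} [IsFiniteMeasure μ]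
    (h : ∀ A : Set (Set ι), IsLocalEvent A → μ (SiteConfig.relabel e ⁻¹' A) = μ A) :
    MeasurePreserving (SiteConfig.relabel e) μ μ := by
  refine ⟨(SiteConfig.relabel e).measurable, ?_⟩
  haveI : IsFiniteMeasure (μ.map (SiteConfig.relabel e)) :=
    Measure.isFiniteMeasure_map μ _
  refine ext_of_isLocalEvent fun A hA => ?_
  rw [Measure.map_apply (SiteConfig.relabel e).measurable (measurableSet_of_isLocalEvent_holds hA)]
  exact h A hA

end LocalAlgebra

/-! ### Boolean coordinates and finite-dimensional laws -/

section Coordinates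

variable (ι)

open Classical in
/-- Configurations as Boolean functions: the measurable equivalence `(ι → Bool) ≃ᵐ Set ι`,
`f ↦ {i | f i}`, used to transport Kolmogorov's extension theorem (stated in the tree for products
of Polish spaces) to the configuration space `Set ι`. [folklore] -/
def boolFunEquivSet : (ι → Bool) ≃ᵐ Set ι where
  toFun f := {i | f i = true}
  invFun ω := fun i => decide (i ∈ ω)
  left_inv f := by funext i; simp
  right_inv ω := by ext i; simp
  measurable_toFun := by
    refine measurable_set_iff.2 fun i => measurable_to_prop ?_
    have : (fun f : ι → Bool => i ∈ {j | f j = true}) ⁻¹' {True} = (fun f : ι → Bool => f i) ⁻¹' {true} := by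
      ext f; simp
    show MeasurableSet ((fun f : ι → Bool => i ∈ {j | f j = true}) ⁻¹' {True})
    rw [this]
    exact measurable_pi_apply i (MeasurableSet.singleton true)
  measurable_invFun := by
    refine measurable_pi_iff.2 fun i => measurable_to_bool ?_
    have : (fun ω : Set ι => decide (i ∈ ω)) ⁻¹' {true} = {ω | i ∈ ω} := by
      ext ω; simp
    show MeasurableSet ((fun ω : Set ι => decide (i ∈ ω)) ⁻¹' {true})
    rw [this]
    exact measurableSet_mem i

variable {ι}

/-- `i ∈ boolFunEquivSet f ↔ f i`. [folklore] -/
@[simp] theorem mem_boolFunEquivSet_iff (f : ι → Bool) (i : ι) :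
    i ∈ boolFunEquivSet ι f ↔ f i = true := Iff.rfl

open Classical in
/-- The inverse: `(boolFunEquivSet)⁻¹ ω i = decide (i ∈ ω)`. [folklore] -/
@[simp] theorem boolFunEquivSet_symm_apply (ω : Set ι) (i : ι) :
    (boolFunEquivSet ι).symm ω i = decide (i ∈ ω) := rfl

open Classical in
/-- The coordinate projection of a configuration on a finite window `J`:
`ω ↦ (j ↦ [j ∈ ω])_{j ∈ J}`. [folklore] -/
def windowProj (J : Finset ι) (ω : Set ι) : J → Bool := fun j => decide ((j : ι) ∈ ω)

open Classical in
/-- Value of the window projection. [folklore] -/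
@[simp] theorem windowProj_apply (J : Finset ι) (ω : Set ι) (j : J) :
    windowProj J ω j = decide ((j : ι) ∈ ω) := rfl

/-- `windowProj J = J.restrict ∘ boolFunEquivSet⁻¹`. [folklore] -/
theorem windowProj_eq_restrict_comp (J : Finset ι) :
    windowProj J = (fun f : ι → Bool => J.restrict f) ∘ (boolFunEquivSet ι).symm := by
  funext ω; funext j; rfl

/-- The window projection is measurable. [folklore] -/
theorem measurable_windowProj (J : Finset ι) : Measurable (windowProj (ι := ι) J) := by
  rw [windowProj_eq_restrict_comp]
  exact (Finset.measurable_restrict J).comp (boolFunEquivSet ι).symm.measurable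

/-- Preimages of the window projection are local events, determined by the window. [folklore] -/
theorem determinedBy_preimage_windowProj (J : Finset ι) (S : Set (J → Bool)) :
    DeterminedBy (windowProj J ⁻¹' S) (↑J : Set ι) := by
  classical
  rw [determinedBy_iff]
  intro ω ω' hω
  have hproj : windowProj J ω = windowProj J ω' := by
    funext j
    have h := Set.ext_iff.1 hω (j : ι)
    simp only [Set.mem_inter_iff, Finset.mem_coe, j.2, and_true] at h
    simp only [windowProj_apply, h]
  simp only [Set.mem_preimage, hproj]

/-- Preimages of the window projection are local events. [folklore] -/
theorem isLocalEvent_preimage_windowProj (J : Finset ι) (S : Set (J → Bool)) :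
    IsLocalEvent (windowProj J ⁻¹' S) :=
  ⟨J, determinedBy_preimage_windowProj J S⟩

/-- **A local event is a cylinder**: an event determined by the finite window `J` is the preimage
under the window projection of its set of patterns (Grimmett 1999, §2.2). [folklore] -/
theorem DeterminedBy.eq_preimage_windowProj {A : Set (Set ι)} {J : Finset ι}
    (hA : DeterminedBy A (↑J : Set ι)) : A = windowProj J ⁻¹' (windowProj J '' A) := by
  classical
  rw [determinedBy_iff] at hA
  ext ω
  simp only [Set.mem_preimage, Set.mem_image]
  constructor
  · exact fun h => ⟨ω, h, rfl⟩
  · rintro ⟨ω', hω', heq⟩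
    refine (hA ω' ω ?_).1 hω'
    ext i
    simp only [Set.mem_inter_iff, Finset.mem_coe]
    constructor
    · rintro ⟨hi, hiJ⟩
      have h := congrFun heq ⟨i, hiJ⟩
      simp only [windowProj_apply, decide_eq_decide] at h
      exact ⟨h.1 hi, hiJ⟩
    · rintro ⟨hi, hiJ⟩
      have h := congrFun heq ⟨i, hiJ⟩
      simp only [windowProj_apply, decide_eq_decide] at h
      exact ⟨h.2 hi, hiJ⟩

/-- On Boolean functions, a window-preimage event is Mathlib's `cylinder`. [folklore] -/
theorem preimage_boolFunEquivSet_preimage_windowProj (J : Finset ι) (S : Set (J → Bool)) :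
    boolFunEquivSet ι ⁻¹' (windowProj J ⁻¹' S) = cylinder J S := by
  classical
  ext f
  simp only [Set.mem_preimage, mem_cylinder]
  have : windowProj J (boolFunEquivSet ι f) = J.restrict f := by
    funext j; simp [Finset.restrict]
  rw [this]

end Coordinates

/-! ### Existence of the local limit (Kolmogorov) -/

section Existence

/-- **Existence of the thermodynamic limit on local events.** Let `μ_L` be probability measures on
the configuration space `Set ι` (any index type) such that `μ_L(A)` converges for every local event
`A`. Then there is a probability measure `μ` with `μ(A) = lim_L μ_L(A)` for all local
`A`: the limits of the finite-dimensional laws form a projective family of probability measures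
on the finite spaces `{0,1}^J`, which Kolmogorov's extension theorem (the tree's
`Literature.Probability.Process.isProjectiveLimit_projectiveLimit_holds`, on `ι → Bool`) extends to a measure, transported
to `Set ι` by `boolFunEquivSet`. [folklore] -/
theorem exists_measure_tendsto_of_isLocalEvent (μs : ℕ → Measure (Set ι))
    [∀ L, IsProbabilityMeasure (μs L)]
    (hconv : ∀ A : Set (Set ι), IsLocalEvent A → ∃ a : ℝ≥0∞, Tendsto (fun L => μs L A) atTop (𝓝 a)) :
    ∃ μ : Measure (Set ι), IsProbabilityMeasure μ ∧
      ∀ A : Set (Set ι), IsLocalEvent A → Tendsto (fun L => μs L A) atTop (𝓝 (μ A)) := by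
  classical
  -- limits of the pattern probabilities
  have hpat : ∀ (J : Finset ι) (S : Set (J → Bool)),
      ∃ a : ℝ≥0∞, Tendsto (fun L => μs L (windowProj J ⁻¹' S)) atTop (𝓝 a) := fun J S =>
    hconv _ (isLocalEvent_preimage_windowProj J S)
  choose lim hlim using hpat
  -- the limiting finite-dimensional laws
  let P : ∀ J : Finset ι, Measure (J → Bool) := fun J =>
    ∑ g : J → Bool, lim J {g} • Measure.dirac g
  have hP_apply : ∀ (J : Finset ι) (S : Set (J → Bool)),
      P J S = ∑ g ∈ Finset.univ.filter (· ∈ S), lim J {g} := by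
    intro J S
    simp only [P, Measure.coe_finsetSum, Measure.coe_smul, Finset.sum_apply, Pi.smul_apply,
      smul_eq_mul]
    rw [← Finset.sum_filter_add_sum_filter_not Finset.univ (· ∈ S)]
    have h0 : ∑ g ∈ Finset.univ.filter (fun g => g ∉ S), lim J {g} * Measure.dirac g S = 0 :=
      Finset.sum_eq_zero fun g hg => by
        rw [Measure.dirac_apply' _ MeasurableSet.of_discrete,
          Set.indicator_of_notMem (Finset.mem_filter.1 hg).2, mul_zero]
    rw [h0, add_zero]
    refine Finset.sum_congr rfl fun g hg => ?_
    rw [Measure.dirac_apply_of_mem (Finset.mem_filter.1 hg).2, mul_one]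
  -- the pattern probabilities of `μ_L` add up over `S`
  have hsum : ∀ (L : ℕ) (J : Finset ι) (S : Set (J → Bool)),
      μs L (windowProj J ⁻¹' S) = ∑ g ∈ Finset.univ.filter (· ∈ S), μs L (windowProj J ⁻¹' {g}) := by
    intro L J S
    have hdecomp : windowProj J ⁻¹' S = ⋃ g ∈ Finset.univ.filter (· ∈ S), windowProj J ⁻¹' {g} := by
      ext ω; simp
    rw [hdecomp, measure_biUnion_finset]
    · intro g _ g' _ hne
      exact Disjoint.preimage _ (Set.disjoint_singleton.2 hne)
    · intro g _
      exact measurable_windowProj J (MeasurableSet.singleton g)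
  -- hence `μ_L(windowProj J ⁻¹' S) → P J S`
  have hPlim : ∀ (J : Finset ι) (S : Set (J → Bool)),
      Tendsto (fun L => μs L (windowProj J ⁻¹' S)) atTop (𝓝 (P J S)) := by
    intro J S
    rw [hP_apply]
    simp_rw [hsum _ J S]
    exact tendsto_finsetSum _ fun g _ => hlim J {g}
  have hPprob : ∀ J, IsProbabilityMeasure (P J) := fun J => ⟨by
    have h := hPlim J Set.univ
    simp only [Set.preimage_univ, measure_univ] at h
    exact (tendsto_nhds_unique tendsto_const_nhds h).symm⟩
  -- projectivity
  have hproj : IsProjectiveMeasureFamily (α := fun _ : ι => Bool) P := by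
    intro I J hJI
    refine Measure.ext fun S hS => ?_
    rw [Measure.map_apply (Finset.measurable_restrict₂ hJI) hS]
    refine tendsto_nhds_unique (hPlim J S) ?_
    have heq : ∀ L, μs L (windowProj J ⁻¹' S) =
        μs L (windowProj I ⁻¹' (Finset.restrict₂ (π := fun _ : ι => Bool) hJI ⁻¹' S)) := by
      intro L; rfl
    simp_rw [heq]
    exact hPlim I _
  -- Kolmogorov extension on `ι → Bool`, transported to `Set ι`
  haveI : ∀ i : ι, PolishSpace ((fun _ : ι => Bool) i) := fun _ => inferInstance
  haveI : ∀ i : ι, BorelSpace ((fun _ : ι => Bool) i) := fun _ => inferInstance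
  have hνP := Literature.Probability.Process.isProjectiveLimit_projectiveLimit_holds (α := fun _ : ι => Bool) hproj
  set ν : Measure (ι → Bool) := Literature.Probability.Process.projectiveLimit P with hν
  haveI : IsProbabilityMeasure ν := hνP.isProbabilityMeasure
  refine ⟨ν.map (boolFunEquivSet ι),
    Measure.isProbabilityMeasure_map (boolFunEquivSet ι).measurable.aemeasurable, ?_⟩
  intro A hA
  obtain ⟨J, hJ⟩ := hA
  have hAeq := hJ.eq_preimage_windowProj
  set S := windowProj J '' A with hSdef
  rw [hAeq, Measure.map_apply (boolFunEquivSet ι).measurable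
    (measurableSet_of_isLocalEvent_holds (isLocalEvent_preimage_windowProj J S)),
    preimage_boolFunEquivSet_preimage_windowProj, hνP.measure_cylinder J MeasurableSet.of_discrete]
  exact hPlim J S

/-- **Uniqueness of the local limit**: two finite measures which are both limits of `μ_L` on local
events coincide. [folklore] -/
theorem measure_unique_of_tendsto_isLocalEvent (μs : ℕ → Measure (Set ι)) {μ ν : Measure (Set ι)}
    [IsFiniteMeasure μ]
    (hμ : ∀ A : Set (Set ι), IsLocalEvent A → Tendsto (fun L => μs L A) atTop (𝓝 (μ A)))
    (hν : ∀ A : Set (Set ι), IsLocalEvent A → Tendsto (fun L => μs L A) atTop (𝓝 (ν A))) :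
    μ = ν :=
  ext_of_isLocalEvent fun A hA => tendsto_nhds_unique (hμ A hA) (hν A hA)

end Existence

/-! ### The zero–one law under asymptotic mixing -/

section ZeroOne

/-- **Zero–one law for translation-invariant events from asymptotic mixing on local events**
(the tree's `measure_eq_zero_or_one_of_preimage_eq_of_mixing`, `ZeroOneLawMixing.lean`, with `C` = the ring of local events). If a relabelling `T` of the
coordinates preserves the probability measure `μ` on `Set ι` and is asymptotically mixing on local
events — for every local `B` and `δ > 0` some iterate has `|μ(B ∩ T⁻ⁿB) - μ(B)²| < δ` — then every
measurable `T`-invariant event has probability `0` or `1` (Aizenman–Duminil-Copin–Sidoravicius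
2015, Thm. 2.3 (R3): "ergodicity … it is sufficient to prove that for any events `A` and `B`
depending on a finite number of edges, `lim ℙ[A ∩ τ_x B] = ℙ[A]ℙ[B]`"). [cite: AizenmanDuminilCopinSidoraviciusCMP2015, Thm. 2.3 (R3)] -/
theorem measure_eq_zero_or_one_of_asymptotic_mixing_isLocalEvent {μ : Measure (Set ι)}
    [IsProbabilityMeasure μ] (e : ι ≃ ι) (hT : MeasurePreserving (SiteConfig.relabel e) μ μ)
    (hmix : ∀ B : Set (Set ι), IsLocalEvent B → ∀ δ : ℝ, 0 < δ →
      ∃ n : ℕ, |μ.real (B ∩ (SiteConfig.relabel e)^[n] ⁻¹' B) - μ.real B * μ.real B| < δ)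
    {A : Set (Set ι)} (hA : MeasurableSet A) (hinv : SiteConfig.relabel e ⁻¹' A = A) :
    μ A = 0 ∨ μ A = 1 :=
  measure_eq_zero_or_one_of_preimage_eq_of_mixing isSetRing_isLocalEvent
    ⟨{Set.univ}, Set.countable_singleton _, by simpa using isLocalEvent_univ, by simp⟩
    generateFrom_isLocalEvent.symm hT hmix hA hinv

/-- Bundled form: under asymptotic mixing on local events the relabelling is `Ergodic`. [folklore] -/
theorem ergodic_relabel_of_asymptotic_mixing_isLocalEvent {μ : Measure (Set ι)}
    [IsProbabilityMeasure μ] (e : ι ≃ ι) (hT : MeasurePreserving (SiteConfig.relabel e) μ μ)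
    (hmix : ∀ B : Set (Set ι), IsLocalEvent B → ∀ δ : ℝ, 0 < δ →
      ∃ n : ℕ, |μ.real (B ∩ (SiteConfig.relabel e)^[n] ⁻¹' B) - μ.real B * μ.real B| < δ) :
    Ergodic (SiteConfig.relabel e) μ := by
  refine ⟨hT, ⟨fun A hA hinv => ?_⟩⟩
  rw [Filter.eventuallyConst_set']
  rcases measure_eq_zero_or_one_of_asymptotic_mixing_isLocalEvent e hT hmix hA hinv with h0 | h1
  · exact Or.inl (ae_eq_empty.2 h0)
  · exact Or.inr (ae_eq_univ.2 ((prob_compl_eq_zero_iff hA).2 h1))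

end ZeroOne

/-! ### Transferring support, inequalities and invariance to the limit -/

section Transfer

/-- Inequalities between the measures of local events pass to the local limit. [folklore] -/
theorem le_of_tendsto_isLocalEvent {μs : ℕ → Measure (Set ι)} {μ : Measure (Set ι)}
    (hμ : ∀ A : Set (Set ι), IsLocalEvent A → Tendsto (fun L => μs L A) atTop (𝓝 (μ A)))
    {c : ℝ≥0∞} (hc : c ≠ ⊤) {A B : Set (Set ι)} (hA : IsLocalEvent A) (hB : IsLocalEvent B)
    (h : ∀ L, c * μs L A ≤ μs L B) : c * μ A ≤ μ B :=
  le_of_tendsto_of_tendsto (b := atTop) (ENNReal.Tendsto.const_mul (hμ A hA) (Or.inr hc)) (hμ B hB)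
    (Filter.Eventually.of_forall h)

/-- A coordinate which is almost surely absent in every `μ_L` is almost surely absent in the local
limit. [folklore] -/
theorem measure_setOf_mem_eq_zero_of_tendsto {μs : ℕ → Measure (Set ι)} {μ : Measure (Set ι)}
    (hμ : ∀ A : Set (Set ι), IsLocalEvent A → Tendsto (fun L => μs L A) atTop (𝓝 (μ A)))
    {i : ι} (h : ∀ L, μs L {ω | i ∈ ω} = 0) : μ {ω | i ∈ ω} = 0 := by
  have ht := hμ _ (isLocalEvent_setOf_mem i)
  simp_rw [h] at ht
  exact tendsto_nhds_unique ht tendsto_const_nhds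

/-- **Support**: if every coordinate outside `E₀` is almost surely absent, the configuration is
almost surely contained in `E₀` (countably many null events). [folklore] -/
theorem ae_subset_of_measure_setOf_mem_eq_zero [Countable ι] (μ : Measure (Set ι)) (E₀ : Set ι)
    (h : ∀ i, i ∉ E₀ → μ {ω | i ∈ ω} = 0) : ∀ᵐ ω ∂μ, ω ⊆ E₀ := by
  have : {ω : Set ι | ¬ ω ⊆ E₀} = ⋃ i ∈ E₀ᶜ, {ω | i ∈ ω} := by
    ext ω
    simp only [Set.mem_setOf_eq, Set.not_subset, Set.mem_iUnion, Set.mem_compl_iff, exists_prop]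
    exact ⟨fun ⟨i, hi, hiE⟩ => ⟨i, hiE, hi⟩, fun ⟨i, hiE, hi⟩ => ⟨i, hi, hiE⟩⟩
  rw [ae_iff, this]
  exact (measure_biUnion_null_iff (Set.to_countable _)).2 fun i hi => h i hi

/-- Inserting the coordinates of `F` maps local events to local events (general index type; for
bond configurations and `openEdges` this is `IsLocalEvent.preimage_openEdges`,
`LocalEventsComparison.lean`). [folklore] -/
theorem IsLocalEvent.preimage_union (F : Set ι) {A : Set (Set ι)} (hA : IsLocalEvent A) :
    IsLocalEvent ((· ∪ F) ⁻¹' A) := by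
  obtain ⟨J, hJ⟩ := hA
  refine ⟨J, ?_⟩
  rw [determinedBy_iff] at hJ ⊢
  intro ω ω' hω
  simp only [Set.mem_preimage]
  refine hJ _ _ ?_
  rw [Set.union_inter_distrib_right, Set.union_inter_distrib_right, hω]

/-- The insertion map `ω ↦ ω ∪ F` is measurable. [folklore] -/
theorem measurable_union_const (F : Set ι) : Measurable fun ω : Set ι => ω ∪ F :=
  measurable_set_iff.2 fun i => (measurable_set_mem i).or measurable_const

/-- **Insertion-type inequalities pass from local events to all events**: if
`c · μ{ω : ω ∪ F ∈ A} ≤ μ(A)` for all local `A` (and `c < ∞`), then for all measurable `A`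
(compare `c • μ ∘ (· ∪ F)⁻¹` and `μ` with `measure_le_of_forall_isLocalEvent_le`,
`LocalEventsComparison.lean`). [folklore] -/
theorem mul_measure_preimage_union_le_of_isLocalEvent {μ : Measure (Set ι)} [IsFiniteMeasure μ]
    (F : Set ι) {c : ℝ≥0∞} (hc : c ≠ ⊤)
    (h : ∀ A : Set (Set ι), IsLocalEvent A → c * μ ((· ∪ F) ⁻¹' A) ≤ μ A)
    {s : Set (Set ι)} (hs : MeasurableSet s) : c * μ ((· ∪ F) ⁻¹' s) ≤ μ s := by
  set ν : Measure (Set ι) := c • μ.map (· ∪ F) with hν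
  haveI : IsFiniteMeasure (μ.map (· ∪ F)) := Measure.isFiniteMeasure_map μ _
  haveI : IsFiniteMeasure ν := by
    refine ⟨?_⟩
    rw [hν, Measure.smul_apply, smul_eq_mul]
    exact ENNReal.mul_lt_top hc.lt_top (measure_lt_top _ _)
  have hνapply : ∀ A : Set (Set ι), MeasurableSet A → ν A = c * μ ((· ∪ F) ⁻¹' A) := by
    intro A hA
    rw [hν, Measure.smul_apply, smul_eq_mul, Measure.map_apply (measurable_union_const F) hA]
  rw [← hνapply s hs]
  exact measure_le_of_forall_isLocalEvent_le
    (fun A hA => (hνapply A (measurableSet_of_isLocalEvent_holds hA)) ▸ h A hA) hs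

end Transfer

end Literature.Probability.Percolation
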